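import Literature.Analysis.Complex.DeBruijnUniversalFactorsProofs
import Mathlib
import HarnessLib

/-!
# S1 programme (⟨stmt-QuantumFields-23125⟩) — one-dimensional core of `PringsheimIdentification`

Crux `F4SubCurvatureDoor.RationalToGeneral` ⟨stmt-QuantumFields-23125⟩, owner file `Cruxes/RationalToGeneral/Lines/forward_cone_rungs.lean`
(ns `…ForwardConeRungs`, v4).  Pure one-variable analysis (Mathlib, plus the tree's `cosh x ≤ e^{|x|}`):

* `hasSum_integral_cosh` / `integrable_cosh_of_summable` — Tonelli for `∫ cosh(rq) dm = Σ_k r^{2k} m_{2k}/(2k)!` in both directions;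
* `hasFPowerSeriesOnBall_cosTransform` — with an exponential moment `∫ e^{δ₀|q|} dm < ∞` the complex cosine transform
  `H(w) = ∫ cos(wq) dm` has the power series `Σ_k (−1)^k m_{2k} w^{2k}/(2k)!` on the ball of radius `δ₀` (dominated convergence);
* `cosh_integral_le_of_holomorphic` — **the strip/Pringsheim step**: if a function `g` holomorphic and bounded by `M` on the disc of radius `ρ`
  agrees with the real cosine transform `s ↦ ∫ cos(sq) dm` on `(−ρ, ρ)`, and `m` has SOME exponential moment, then for every `δ < ρ` the
  measure has the exponential moment `δ` and `∫ cosh(δq) dm = Re g(iδ) ≤ M` (identity theorem near `0`, uniqueness of the power series at `0`,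
  evaluation at `iδ`, Tonelli).

It is the engine of `LukacsOneDim → PringsheimIdentification` (file `…PringsheimOfLukacs`).  HONEST LABEL: analysis helper for rungs of the OPEN
stub S1; nothing of S1/⟨23125⟩/⟨23035⟩/R2d is proved and the Yang–Mills mass gap is NOT proved; no summit is proved by a line.
Lead seat `ym-line-sfw-p2` g75 (cell ym-idea-1, free hands).
-/

set_option autoImplicit false

noncomputable section

open MeasureTheory Filter Topology Set Metric
open scoped BigOperators NNReal ENNReal

namespace Summit.QuantumFields.YangMills.Theorems.F4SubCurvatureDoorPringsheimCore

open Literature.Analysis.Complex.DeBruijn1950 (cosh_le_exp_abs)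

variable {m : Measure ℝ}

/-! ## Moments and the two Tonelli directions for `cosh` -/

/-- The moments `mₙ = ∫ qⁿ dm`. -/
def mom (m : Measure ℝ) (n : ℕ) : ℝ := ∫ q, q ^ n ∂m

/-- Even powers are integrable against a measure with an exponential moment. -/
theorem integrable_pow_of_exp {δ₀ : ℝ} (hδ₀ : 0 < δ₀) (hexp : Integrable (fun q : ℝ => Real.exp (δ₀ * |q|)) m) (n : ℕ) :
    Integrable (fun q : ℝ => q ^ n) m := by
  have hbound : ∀ q : ℝ, ‖q ^ n‖ ≤ (n.factorial / δ₀ ^ n) * Real.exp (δ₀ * |q|) := by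
    intro q
    rw [norm_pow, Real.norm_eq_abs]
    have h := Real.pow_div_factorial_le_exp (δ₀ * |q|) (mul_nonneg hδ₀.le (abs_nonneg q)) n
    rw [mul_pow, div_le_iff₀ (by positivity)] at h
    rw [div_mul_eq_mul_div, le_div_iff₀ (by positivity)]
    linarith
  exact Integrable.mono' (hexp.const_mul _) (by fun_prop) (ae_of_all _ hbound)

/-- `cosh(rq) = Σ_k r^{2k} q^{2k}/(2k)!` pointwise. -/
theorem hasSum_cosh_mul (r q : ℝ) :
    HasSum (fun k : ℕ => r ^ (2 * k) / (2 * k).factorial * q ^ (2 * k)) (Real.cosh (r * q)) := by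
  have h := Real.hasSum_cosh (r * q)
  refine h.congr_fun fun k => ?_
  rw [mul_pow]; ring

/-- The coefficients `r^{2k}/(2k)!` are non-negative. -/
theorem coeff_nonneg (r : ℝ) (k : ℕ) : 0 ≤ r ^ (2 * k) / (2 * k).factorial :=
  div_nonneg ((even_two_mul k).pow_nonneg r) (Nat.cast_nonneg _)

/-- TONELLI (forward): if `cosh(rq)` is integrable, `∫ cosh(rq) dm = Σ_k r^{2k} m_{2k}/(2k)!`. -/
theorem hasSum_integral_cosh {r : ℝ} (hint : ∀ k : ℕ, Integrable (fun q : ℝ => q ^ (2 * k)) m)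
    (hcosh : Integrable (fun q : ℝ => Real.cosh (r * q)) m) :
    HasSum (fun k : ℕ => r ^ (2 * k) / (2 * k).factorial * mom m (2 * k)) (∫ q, Real.cosh (r * q) ∂m) := by
  have key := hasSum_integral_of_dominated_convergence (μ := m)
    (F := fun (k : ℕ) (q : ℝ) => r ^ (2 * k) / (2 * k).factorial * q ^ (2 * k)) (f := fun q => Real.cosh (r * q))
    (fun k q => r ^ (2 * k) / (2 * k).factorial * q ^ (2 * k)) (fun k => ((hint k).const_mul _).aestronglyMeasurable)
    (fun k => ae_of_all _ fun q => by
      rw [Real.norm_eq_abs, abs_of_nonneg (mul_nonneg (coeff_nonneg r k) ((even_two_mul k).pow_nonneg q))])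
    (ae_of_all _ fun q => (hasSum_cosh_mul r q).summable)
    (hcosh.congr (ae_of_all _ fun q => ((hasSum_cosh_mul r q).tsum_eq).symm))
    (ae_of_all _ fun q => hasSum_cosh_mul r q)
  refine key.congr_fun fun k => ?_
  show r ^ (2 * k) / (2 * k).factorial * mom m (2 * k) = ∫ q, r ^ (2 * k) / (2 * k).factorial * q ^ (2 * k) ∂m
  rw [integral_const_mul]; rfl

/-- TONELLI (backward): if the even moments exist and `Σ_k r^{2k} m_{2k}/(2k)!` converges, `cosh(rq)` is integrable. -/
theorem integrable_cosh_of_summable {r : ℝ} (hint : ∀ k : ℕ, Integrable (fun q : ℝ => q ^ (2 * k)) m)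
    (hsum : Summable fun k : ℕ => r ^ (2 * k) / (2 * k).factorial * mom m (2 * k)) :
    Integrable (fun q : ℝ => Real.cosh (r * q)) m := by
  have hFnn : ∀ (k : ℕ) (q : ℝ), 0 ≤ r ^ (2 * k) / (2 * k).factorial * q ^ (2 * k) := fun k q =>
    mul_nonneg (coeff_nonneg r k) ((even_two_mul k).pow_nonneg q)
  have hterm : ∀ k : ℕ, 0 ≤ r ^ (2 * k) / (2 * k).factorial * mom m (2 * k) := fun k =>
    mul_nonneg (coeff_nonneg r k) (integral_nonneg fun q => (even_two_mul k).pow_nonneg q)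
  have h1 : ∫⁻ q, ENNReal.ofReal (Real.cosh (r * q)) ∂m =
      ∑' k : ℕ, ENNReal.ofReal (r ^ (2 * k) / (2 * k).factorial * mom m (2 * k)) := by
    calc ∫⁻ q, ENNReal.ofReal (Real.cosh (r * q)) ∂m
        = ∫⁻ q, ∑' k : ℕ, ENNReal.ofReal (r ^ (2 * k) / (2 * k).factorial * q ^ (2 * k)) ∂m := by
          refine lintegral_congr fun q => ?_
          rw [← ENNReal.ofReal_tsum_of_nonneg (fun k => hFnn k q) (hasSum_cosh_mul r q).summable,
            (hasSum_cosh_mul r q).tsum_eq]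
      _ = ∑' k : ℕ, ∫⁻ q, ENNReal.ofReal (r ^ (2 * k) / (2 * k).factorial * q ^ (2 * k)) ∂m :=
          lintegral_tsum fun k => (((hint k).const_mul _).aestronglyMeasurable.aemeasurable).ennreal_ofReal
      _ = ∑' k : ℕ, ENNReal.ofReal (r ^ (2 * k) / (2 * k).factorial * mom m (2 * k)) := by
          refine tsum_congr fun k => ?_
          rw [← ofReal_integral_eq_lintegral_ofReal ((hint k).const_mul _) (ae_of_all _ (hFnn k)), integral_const_mul]
          rfl
  have h2 : ∑' k : ℕ, ENNReal.ofReal (r ^ (2 * k) / (2 * k).factorial * mom m (2 * k)) =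
      ENNReal.ofReal (∑' k : ℕ, r ^ (2 * k) / (2 * k).factorial * mom m (2 * k)) :=
    (ENNReal.ofReal_tsum_of_nonneg hterm hsum).symm
  refine ⟨by fun_prop, ?_⟩
  rw [hasFiniteIntegral_iff_ofReal (ae_of_all _ fun q => (Real.cosh_pos _).le), h1, h2]
  exact ENNReal.ofReal_lt_top

/-! ## The complex cosine transform and its power series at `0` -/

/-- Taylor coefficients of the cosine transform: `a_{2k} = (−1)^k m_{2k}/(2k)!`, `a_{2k+1} = 0`. -/
def coef (m : Measure ℝ) (n : ℕ) : ℂ :=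
  if Even n then (-1 : ℂ) ^ (n / 2) * (mom m n : ℂ) / (n.factorial : ℂ) else 0

/-- The even coefficients. -/
theorem coef_two_mul (m : Measure ℝ) (k : ℕ) :
    coef m (2 * k) = (-1 : ℂ) ^ k * (mom m (2 * k) : ℂ) / ((2 * k).factorial : ℂ) := by
  simp [coef, Nat.mul_div_cancel_left k two_pos]

/-- The odd coefficients vanish. -/
theorem coef_two_mul_add_one (m : Measure ℝ) (k : ℕ) : coef m (2 * k + 1) = 0 := by
  simp [coef]

/-- The formal power series `Σ aₙ wⁿ`. -/
def P (m : Measure ℝ) : FormalMultilinearSeries ℂ ℂ ℂ := FormalMultilinearSeries.ofScalars ℂ (coef m)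

/-- Its terms. -/
theorem P_apply (m : Measure ℝ) (n : ℕ) (w : ℂ) : P m n (fun _ => w) = coef m n * w ^ n := by
  rw [P, FormalMultilinearSeries.ofScalars_apply_eq, smul_eq_mul]

/-- The complex cosine transform `H(w) = ∫ cos(wq) dm`. -/
def H (m : Measure ℝ) (w : ℂ) : ℂ := ∫ q : ℝ, Complex.cos (w * q) ∂m

/-- On real arguments `H` is the real cosine transform. -/
theorem H_ofReal (m : Measure ℝ) (s : ℝ) : H m (s : ℂ) = ((∫ q : ℝ, Real.cos (s * q) ∂m : ℝ) : ℂ) := by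
  rw [H, ← integral_complex_ofReal]
  refine integral_congr_ae (ae_of_all _ fun q => ?_)
  simp [← Complex.ofReal_mul, Complex.ofReal_cos]

/-- The `k`-th term of the complex cosine series integrates to `a_{2k} w^{2k}`. -/
theorem integral_cos_term {δ₀ : ℝ} (hδ₀ : 0 < δ₀) (hexp : Integrable (fun q : ℝ => Real.exp (δ₀ * |q|)) m) (w : ℂ) (k : ℕ) :
    ∫ q : ℝ, (-1 : ℂ) ^ k * (w * q) ^ (2 * k) / ((2 * k).factorial : ℂ) ∂m = coef m (2 * k) * w ^ (2 * k) := by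
  have hint := integrable_pow_of_exp hδ₀ hexp (2 * k)
  have h1 : ∀ q : ℝ, (-1 : ℂ) ^ k * (w * q) ^ (2 * k) / ((2 * k).factorial : ℂ) =
      ((-1 : ℂ) ^ k * w ^ (2 * k) / ((2 * k).factorial : ℂ)) * ((q ^ (2 * k) : ℝ) : ℂ) := by
    intro q; push_cast; ring
  simp_rw [h1]
  rw [integral_const_mul, integral_complex_ofReal, coef_two_mul]
  simp only [mom]
  ring

/-- The norm of the `k`-th term of the complex cosine series. -/
theorem norm_cos_term (w : ℂ) (q : ℝ) (k : ℕ) :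
    ‖(-1 : ℂ) ^ k * (w * q) ^ (2 * k) / ((2 * k).factorial : ℂ)‖ = ‖w‖ ^ (2 * k) / (2 * k).factorial * q ^ (2 * k) := by
  rw [norm_div, norm_mul, norm_pow, norm_neg, norm_one, one_pow, one_mul, norm_pow, norm_mul, Complex.norm_real,
    Real.norm_eq_abs, Complex.norm_natCast, mul_pow, Even.pow_abs (even_two_mul k)]
  ring

/-- DOMINATED CONVERGENCE (even part): `Σ_k ∫ (−1)^k (wq)^{2k}/(2k)! dm = H(w)` for `‖w‖ < δ₀`. -/
theorem hasSum_integral_cos_terms {δ₀ : ℝ} (hexp : Integrable (fun q : ℝ => Real.exp (δ₀ * |q|)) m)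
    {w : ℂ} (hw : ‖w‖ < δ₀) :
    HasSum (fun k : ℕ => ∫ q : ℝ, (-1 : ℂ) ^ k * (w * q) ^ (2 * k) / ((2 * k).factorial : ℂ) ∂m) (H m w) := by
  -- the dominating function `cosh(‖w‖ q) ≤ e^{δ₀|q|}`
  have hdom : Integrable (fun q : ℝ => Real.cosh (‖w‖ * q)) m := by
    refine Integrable.mono' hexp (by fun_prop) (ae_of_all _ fun q => ?_)
    rw [Real.norm_eq_abs, abs_of_pos (Real.cosh_pos _)]
    refine (cosh_le_exp_abs _).trans (Real.exp_le_exp.2 ?_)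
    rw [abs_mul, abs_norm]
    exact mul_le_mul_of_nonneg_right hw.le (abs_nonneg q)
  have hmeas : ∀ k : ℕ,
      AEStronglyMeasurable (fun q : ℝ => (-1 : ℂ) ^ k * (w * q) ^ (2 * k) / ((2 * k).factorial : ℂ)) m := by
    intro k
    have hc : Continuous fun q : ℝ => (-1 : ℂ) ^ k * (w * q) ^ (2 * k) / ((2 * k).factorial : ℂ) := by fun_prop
    exact hc.aestronglyMeasurable
  have hbd : ∀ k : ℕ, ∀ᵐ q : ℝ ∂m,
      ‖(-1 : ℂ) ^ k * (w * q) ^ (2 * k) / ((2 * k).factorial : ℂ)‖ ≤ ‖w‖ ^ (2 * k) / (2 * k).factorial * q ^ (2 * k) :=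
    fun k => ae_of_all _ fun q => (norm_cos_term w q k).le
  have hsu : ∀ᵐ q : ℝ ∂m, Summable fun k : ℕ => ‖w‖ ^ (2 * k) / (2 * k).factorial * q ^ (2 * k) :=
    ae_of_all _ fun q => (hasSum_cosh_mul ‖w‖ q).summable
  have hbi : Integrable (fun q : ℝ => ∑' k : ℕ, ‖w‖ ^ (2 * k) / (2 * k).factorial * q ^ (2 * k)) m :=
    hdom.congr (ae_of_all _ fun q => ((hasSum_cosh_mul ‖w‖ q).tsum_eq).symm)
  have hlim : ∀ᵐ q : ℝ ∂m,
      HasSum (fun k : ℕ => (-1 : ℂ) ^ k * (w * q) ^ (2 * k) / ((2 * k).factorial : ℂ)) (Complex.cos (w * q)) :=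
    ae_of_all _ fun q => Complex.hasSum_cos (w * q)
  exact hasSum_integral_of_dominated_convergence _ hmeas hbd hsu hbi hlim

/-- With an exponential moment `δ₀`, `H(w) = Σₙ aₙ wⁿ` for `‖w‖ < δ₀`. -/
theorem hasSum_H {δ₀ : ℝ} (hδ₀ : 0 < δ₀) (hexp : Integrable (fun q : ℝ => Real.exp (δ₀ * |q|)) m) {w : ℂ}
    (hw : ‖w‖ < δ₀) : HasSum (fun n : ℕ => P m n (fun _ => w)) (H m w) := by
  have heven : HasSum (fun k : ℕ => P m (2 * k) (fun _ => w)) (H m w) := by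
    refine (hasSum_integral_cos_terms hexp hw).congr_fun fun k => ?_
    rw [P_apply, integral_cos_term hδ₀ hexp w k]
  have hodd : HasSum (fun k : ℕ => P m (2 * k + 1) (fun _ => w)) 0 := by
    have : (fun k : ℕ => P m (2 * k + 1) (fun _ => w)) = fun _ => 0 := by
      funext k; rw [P_apply, coef_two_mul_add_one, zero_mul]
    rw [this]; exact hasSum_zero
  have h := HasSum.even_add_odd (f := fun n : ℕ => P m n (fun _ => w)) heven hodd
  rwa [add_zero] at h

/-- With an exponential moment `δ₀`, `cosh(rq)` is integrable for `|r| ≤ δ₀`. -/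
theorem integrable_cosh_of_exp {δ₀ r : ℝ} (hexp : Integrable (fun q : ℝ => Real.exp (δ₀ * |q|)) m) (hr : |r| ≤ δ₀) :
    Integrable (fun q : ℝ => Real.cosh (r * q)) m := by
  refine Integrable.mono' hexp (by fun_prop) (ae_of_all _ fun q => ?_)
  rw [Real.norm_eq_abs, abs_of_pos (Real.cosh_pos _)]
  refine (cosh_le_exp_abs _).trans (Real.exp_le_exp.2 ?_)
  rw [abs_mul]
  exact mul_le_mul_of_nonneg_right hr (abs_nonneg q)

/-- The radius of `P` is at least `δ₀`: `|aₙ| rⁿ ≤ ∫ cosh(rq) dm` for every `r < δ₀`. -/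
theorem le_radius_P {δ₀ : ℝ} (hδ₀ : 0 < δ₀) (hexp : Integrable (fun q : ℝ => Real.exp (δ₀ * |q|)) m) :
    ENNReal.ofReal δ₀ ≤ (P m).radius := by
  refine ENNReal.le_of_forall_nnreal_lt fun r hr => ?_
  have hr' : (r : ℝ) < δ₀ := by
    simp only [ENNReal.ofReal, ENNReal.coe_lt_coe] at hr
    exact Real.lt_toNNReal_iff_coe_lt.1 hr
  have hint := integrable_pow_of_exp hδ₀ hexp
  have hcosh := integrable_cosh_of_exp hexp (show |(r : ℝ)| ≤ δ₀ by rw [NNReal.abs_eq]; exact hr'.le)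
  have hS := hasSum_integral_cosh (fun k => hint (2 * k)) hcosh
  refine (P m).le_radius_of_bound (∫ q, Real.cosh (r * q) ∂m) fun n => ?_
  rw [P, FormalMultilinearSeries.ofScalars_norm]
  rcases Nat.even_or_odd n with ⟨k, hk⟩ | ⟨k, hk⟩
  · rw [hk, ← two_mul, coef_two_mul]
    have hmom : 0 ≤ mom m (2 * k) := integral_nonneg fun q => (even_two_mul k).pow_nonneg q
    have : ‖(-1 : ℂ) ^ k * (mom m (2 * k) : ℂ) / ((2 * k).factorial : ℂ)‖ * (r : ℝ) ^ (2 * k) =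
        (r : ℝ) ^ (2 * k) / (2 * k).factorial * mom m (2 * k) := by
      rw [norm_div, norm_mul, norm_pow, norm_neg, norm_one, one_pow, one_mul, Complex.norm_real, Complex.norm_natCast,
        Real.norm_eq_abs, abs_of_nonneg hmom]
      ring
    rw [this]
    exact le_hasSum hS k fun j _ => mul_nonneg (coeff_nonneg _ j) (integral_nonneg fun q => (even_two_mul j).pow_nonneg q)
  · rw [hk, coef_two_mul_add_one, norm_zero, zero_mul]
    exact integral_nonneg fun q => (Real.cosh_pos _).le

/-- The cosine transform has the power series `P` on the ball of radius `δ₀`. -/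
theorem hasFPowerSeriesOnBall_H {δ₀ : ℝ} (hδ₀ : 0 < δ₀) (hexp : Integrable (fun q : ℝ => Real.exp (δ₀ * |q|)) m) :
    HasFPowerSeriesOnBall (H m) (P m) 0 (ENNReal.ofReal δ₀) where
  r_le := le_radius_P hδ₀ hexp
  r_pos := ENNReal.ofReal_pos.2 hδ₀
  hasSum := fun {w} hw => by
    rw [zero_add]
    refine hasSum_H hδ₀ hexp ?_
    rw [Metric.eball_ofReal, mem_ball_zero_iff] at hw
    exact hw

/-- `‖iδ‖ = δ` for `δ > 0`. -/
theorem norm_I_mul_ofReal {δ : ℝ} (hδ : 0 < δ) : ‖Complex.I * (δ : ℂ)‖ = δ := by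
  rw [norm_mul, Complex.norm_I, one_mul, Complex.norm_real, Real.norm_eq_abs, abs_of_pos hδ]

/-! ## The Pringsheim step -/

/-- **PRINGSHEIM STEP.**  A function `g` holomorphic and bounded by `M` on the disc of radius `ρ` that agrees with the real cosine transform
`s ↦ ∫ cos(sq) dm` on `(−ρ, ρ)`, for a measure `m` with SOME exponential moment `δ₀`, forces the exponential moment `δ` for every `δ < ρ`,
with `∫ cosh(δq) dm = Re g(iδ) ≤ M`. -/
theorem cosh_integral_le_of_holomorphic {ρ M δ₀ : ℝ} (hρ : 0 < ρ) (g : ℂ → ℂ)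
    (hgd : DifferentiableOn ℂ g (Metric.ball 0 ρ)) (hgb : ∀ w ∈ Metric.ball (0 : ℂ) ρ, ‖g w‖ ≤ M)
    (hgr : ∀ s : ℝ, |s| < ρ → g (s : ℂ) = ((∫ q : ℝ, Real.cos (s * q) ∂m : ℝ) : ℂ))
    (hδ₀ : 0 < δ₀) (hexp : Integrable (fun q : ℝ => Real.exp (δ₀ * |q|)) m) {δ : ℝ} (hδ : 0 < δ) (hδρ : δ < ρ) :
    Integrable (fun q : ℝ => Real.cosh (δ * q)) m ∧ ∫ q : ℝ, Real.cosh (δ * q) ∂m ≤ M := by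
  have hint := integrable_pow_of_exp hδ₀ hexp
  -- (1) `g = H` near `0`: identity theorem on the ball of radius `min ρ δ₀`
  have hH := hasFPowerSeriesOnBall_H hδ₀ hexp
  set ρ₁ : ℝ := min ρ δ₀ with hρ₁
  have hρ₁0 : 0 < ρ₁ := lt_min hρ hδ₀
  have hgan : AnalyticOnNhd ℂ g (Metric.ball 0 ρ₁) :=
    (hgd.mono (Metric.ball_subset_ball (min_le_left _ _))).analyticOnNhd Metric.isOpen_ball
  have hHan : AnalyticOnNhd ℂ (H m) (Metric.ball 0 ρ₁) := fun w hw => by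
    refine hH.analyticAt_of_mem ?_
    rw [Metric.eball_ofReal]
    exact Metric.ball_subset_ball (min_le_right _ _) hw
  have hfreq : ∃ᶠ z in 𝓝[≠] (0 : ℂ), g z = H m z := by
    have hpos : ∀ n : ℕ, 0 < ρ₁ / ((n : ℝ) + 2) := fun n => div_pos hρ₁0 (by positivity)
    have hu : Tendsto (fun n : ℕ => ((ρ₁ / ((n : ℝ) + 2) : ℝ) : ℂ)) atTop (𝓝[≠] 0) := by
      refine tendsto_nhdsWithin_iff.2 ⟨?_, Eventually.of_forall fun n => ?_⟩
      · rw [show (0 : ℂ) = ((0 : ℝ) : ℂ) from Complex.ofReal_zero.symm]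
        refine (Complex.continuous_ofReal.tendsto 0).comp ?_
        exact tendsto_const_nhds.div_atTop (tendsto_natCast_atTop_atTop.atTop_add tendsto_const_nhds)
      · simp only [mem_compl_iff, mem_singleton_iff, Complex.ofReal_eq_zero]
        exact (hpos n).ne'
    refine hu.frequently (Frequently.of_forall fun n => ?_)
    have hs : |ρ₁ / ((n : ℝ) + 2)| < ρ := by
      rw [abs_of_pos (hpos n)]
      have h1 : ρ₁ / ((n : ℝ) + 2) ≤ ρ₁ / 2 := by gcongr; linarith [n.cast_nonneg (α := ℝ)]
      linarith [min_le_left ρ δ₀]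
    show g _ = H m _
    rw [hgr _ hs, H_ofReal]
  have hEq : EqOn g (H m) (Metric.ball 0 ρ₁) :=
    hgan.eqOn_of_preconnected_of_frequently_eq hHan (convex_ball 0 ρ₁).isPreconnected (Metric.mem_ball_self hρ₁0) hfreq
  have hgP : HasFPowerSeriesAt g (P m) 0 :=
    hH.hasFPowerSeriesAt.congr (hEq.eventuallyEq_of_mem (Metric.ball_mem_nhds 0 hρ₁0)).symm
  -- (2) the Cauchy series of `g` on the closed disc of radius `ρ' = (δ + ρ)/2` IS `P`
  obtain ⟨ρ', hρ'⟩ : ∃ ρ' : ℝ≥0, (ρ' : ℝ) = (δ + ρ) / 2 := ⟨⟨(δ + ρ) / 2, by positivity⟩, rfl⟩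
  have hρ'ρ : ((ρ' : ℝ)) < ρ := by rw [hρ']; linarith
  have hδρ' : δ < (ρ' : ℝ) := by rw [hρ']; linarith
  have hρ'0 : 0 < ρ' := by rw [← NNReal.coe_pos, hρ']; positivity
  have hg' : HasFPowerSeriesOnBall g (cauchyPowerSeries g 0 ρ') 0 ρ' :=
    (hgd.mono (Metric.closedBall_subset_ball hρ'ρ)).hasFPowerSeriesOnBall hρ'0
  have hPeq : P m = cauchyPowerSeries g 0 ρ' := hgP.eq_formalMultilinearSeries hg'.hasFPowerSeriesAt
  -- (3) evaluate at `iδ`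
  have hmem : Complex.I * (δ : ℂ) ∈ Metric.eball (0 : ℂ) ρ' := by
    rw [← ENNReal.ofReal_coe_nnreal, Metric.eball_ofReal, mem_ball_zero_iff, norm_I_mul_ofReal hδ]
    exact hδρ'
  have hsum := hg'.hasSum hmem
  rw [← hPeq, zero_add] at hsum
  have hsign : ∀ k : ℕ, (-1 : ℂ) ^ k * (-1 : ℂ) ^ k = 1 := fun k => by
    rw [← mul_pow]; simp
  have hsum2 : HasSum (fun k : ℕ => ((δ ^ (2 * k) / (2 * k).factorial * mom m (2 * k) : ℝ) : ℂ))
      (g (Complex.I * δ)) := by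
    have hodd0 : ∀ n ∉ Set.range (fun k : ℕ => 2 * k), P m n (fun _ => Complex.I * δ) = 0 := by
      intro n hn
      rcases Nat.even_or_odd n with ⟨k, hk⟩ | ⟨k, hk⟩
      · exact absurd ⟨k, by simp [hk, two_mul]⟩ hn
      · rw [hk, P_apply, coef_two_mul_add_one, zero_mul]
    have h := (Function.Injective.hasSum_iff (mul_right_injective₀ (two_ne_zero' ℕ)) hodd0).2 hsum
    refine h.congr_fun fun k => ?_
    show ((δ ^ (2 * k) / (2 * k).factorial * mom m (2 * k) : ℝ) : ℂ) = P m (2 * k) (fun _ => Complex.I * δ)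
    rw [P_apply, coef_two_mul, mul_pow, pow_mul Complex.I 2 k, Complex.I_sq]
    push_cast
    linear_combination (-(δ : ℂ) ^ (2 * k) / ((2 * k).factorial : ℂ) * (mom m (2 * k) : ℂ)) * hsign k
  have hre := ((Complex.hasSum_iff _ _).1 hsum2).1
  simp only [Complex.ofReal_re] at hre
  have hcosh : Integrable (fun q : ℝ => Real.cosh (δ * q)) m :=
    integrable_cosh_of_summable (fun k => hint (2 * k)) hre.summable
  refine ⟨hcosh, ?_⟩
  rw [(hasSum_integral_cosh (fun k => hint (2 * k)) hcosh).unique hre]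
  refine (Complex.re_le_norm _).trans (hgb _ ?_)
  rw [mem_ball_zero_iff, norm_I_mul_ofReal hδ]
  exact hδρ

end Summit.QuantumFields.YangMills.Theorems.F4SubCurvatureDoorPringsheimCore

end
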